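import Literature.NumberTheory.EllipticCurves.FormalGroupLogHomAbelProofs
import Literature.NumberTheory.EllipticCurves.FormalGroupLawAssocIntegralProofs
import Literature.NumberTheory.EllipticCurves.FormalGroupLogSummableProofs
import Mathlib.Topology.Algebra.InfiniteSum.Nonarchimedean
import HarnessLib

/-!
# `log_W ∘ z` is a homomorphism on `E₁(ℚ_p)`: discharge of `WeierstrassCurve.padicLogPoint_add`
(Silverman AEC VII.2.2 + IV.6.4(a); proofs only)

Trunk T-NT-EC (Literature/NumberTheory/EllipticCurves). The named fact
`WeierstrassCurve.padicLogPoint_add` (`FormalGroup.lean`): for a minimal Weierstrass equation over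
`ℚ_p` and `P, Q ∈ E₁(ℚ_p)`, `P + Q ∈ E₁(ℚ_p)` and `log_W z(P + Q) = log_W z(P) + log_W z(Q)`, where
`log_W = ∫ω` is the tree's `formalLog` evaluated `p`-adically (`padicLogPoint`). Assembly of
Silverman's proof, all of whose steps are now theorems of the tree:

* `z(P + Q) = F(z(P), z(Q))` with `F` the chord–tangent formal group law (AEC IV.1, VII.2.2):
  `padicEval₂_formalGroupLaw_eq_formalParameter_add`, closure `isInReductionKernel_add`
  (`FormalGroupLawPadicProofs.lean`, `FormalGroupLawAssocIntegralProofs.lean`);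
* `log(F(z₁, z₂)) = log z₁ + log z₂` in `ℚ_p⟦z₁, z₂⟧` (AEC IV.4.2 + IV.5.2, with the
  identification `ω_Ê = ω(z)` of IV.1): the tree's `formalLog_subst_formalGroupLaw`
  (`FormalGroupLogHomAbelProofs.lean`; equivalently `formalLog_subst_formalGroupLaw_of_assoc` of
  `FormalGroupLogHomProofs.lean` with `formalGroupLaw_assoc_of_isIntegral`);
* **AEC IV.6.4(a)**: evaluating that identity at `(s, t) ∈ pℤ_p × pℤ_p` gives
  `log(F(s, t)) = log s + log t` in `ℚ_p` (`padicFormalLog_padicEval₂_formalGroupLaw`). Since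
  `log = Σ (bₙ/n)Tⁿ` is not `p`-integral, the evaluation of `log ∘ F` is justified by an
  unconditional-summability (Fubini) argument in the complete nonarchimedean field `ℚ_p`
  (`hasSum_padicEval₂_powerSeries_subst`: for `‖coeff n f‖ ≤ n`, `A` integral without constant
  term and `‖s‖, ‖t‖ < 1`, the double family `coeff n f · coeff_d(Aⁿ) s^{d₀}t^{d₁}` tends to `0`,
  so `(f ∘ A)(s, t) = f(A(s, t))`), the estimate being AEC IV.6.3(a) (`‖coeff n log‖ ≤ n`,
  `norm_coeff_formalLog_le`).

Main results: `padicFormalLog_padicEval₂_formalGroupLaw`,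
**`padicLogPoint_add_holds : padicLogPoint_add`**.

## Sources

* J. H. Silverman, *The Arithmetic of Elliptic Curves*, 2nd ed. (2009): IV.1, IV.2, IV.4.2, IV.5.2,
  IV.6.3(a), IV.6.4(a), VII.2.2 (`SilvermanAEC2009`).
-/

noncomputable section

open scoped Classical
open Filter PowerSeries Literature.NumberTheory.EllipticCurves
open scoped Topology

namespace Literature.NumberTheory.EllipticCurves

/-! ### Fubini: `(f ∘ A)(s, t) = f(A(s, t))` for `f` with `‖coeff n f‖ ≤ n` -/

section Fubini

variable {p : ℕ} [Fact p.Prime] {f : ℚ_[p]⟦X⟧} {A : MvPowerSeries (Fin 2) ℚ_[p]} {s t : ℚ_[p]}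

/-- `coeff_d(Aⁿ) = 0` for `n > |d|` when `A` has no constant term. [folklore] -/
theorem coeff_pow_eq_zero_of_degree_lt (hA0 : MvPowerSeries.constantCoeff A = 0) {d : Fin 2 →₀ ℕ}
    {n : ℕ} (hn : Finsupp.degree d < n) : MvPowerSeries.coeff d (A ^ n) = 0 := by
  apply MvPowerSeries.coeff_of_lt_order
  have h1 : ((Finsupp.degree d : ℕ) : ℕ∞) < (n : ℕ∞) := by exact_mod_cast hn
  refine lt_of_lt_of_le h1 (le_trans ?_ (MvPowerSeries.le_order_pow n))
  calc ((n : ℕ) : ℕ∞) = n • (1 : ℕ∞) := by simp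
    _ ≤ n • A.order :=
        nsmul_le_nsmul_right (MvPowerSeries.one_le_order_iff_constCoeff_eq_zero.mpr hA0) _

/-- The coefficients of `f ∘ A` as FINITE sums: `coeff_d(f(A)) = Σ_{n ≤ |d|} coeff n f · coeff_d(Aⁿ)`.
[Bourbaki, Algèbre IV §4 no. 3] [folklore] -/
theorem coeff_powerSeries_subst_eq_sum (hA0 : MvPowerSeries.constantCoeff A = 0) (d : Fin 2 →₀ ℕ) :
    MvPowerSeries.coeff d (f.subst A) =
      ∑ n ∈ Finset.range (Finsupp.degree d + 1), coeff n f * MvPowerSeries.coeff d (A ^ n) := by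
  rw [PowerSeries.coeff_subst (PowerSeries.HasSubst.of_constantCoeff_zero hA0)]
  have hsub : (Function.support fun n : ℕ => coeff n f • MvPowerSeries.coeff d (A ^ n)) ⊆
      ↑(Finset.range (Finsupp.degree d + 1)) := by
    intro n hn
    rw [Function.mem_support] at hn
    simp only [Finset.coe_range, Set.mem_Iio]
    by_contra h
    exact hn (by rw [coeff_pow_eq_zero_of_degree_lt hA0 (by omega), smul_zero])
  rw [finsum_eq_sum_of_support_subset _ hsub]
  simp only [smul_eq_mul]

/-- **Summability of the double family** `(n, d) ↦ coeff n f · coeff_d(Aⁿ) · s^{d₀} t^{d₁}` for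
`‖coeff n f‖ ≤ n`, `A` integral without constant term, `‖s‖, ‖t‖ < 1`: its terms vanish unless
`n ≤ |d|` and are bounded by `|d| · r^{|d|}`, `r = max(‖s‖, ‖t‖) < 1`, which tends to `0`;
a family tending to `0` is summable in the complete nonarchimedean field `ℚ_p`.
[Silverman AEC IV.6.3(a) (estimate), IV.6.4(a)] [folklore] -/
theorem summable_coeff_mul_coeff_pow (hf : ∀ n, ‖coeff n f‖ ≤ n) (hA : IsPadicInt A)
    (hA0 : MvPowerSeries.constantCoeff A = 0) (hs : ‖s‖ < 1) (ht : ‖t‖ < 1) :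
    Summable fun x : ℕ × (Fin 2 →₀ ℕ) =>
      coeff x.1 f * (MvPowerSeries.coeff x.2 (A ^ x.1) * (s ^ x.2 0 * t ^ x.2 1)) := by
  refine NonarchimedeanAddGroup.summable_of_tendsto_cofinite_zero ?_
  set r := max ‖s‖ ‖t‖ with hr
  have hr0 : 0 ≤ r := le_max_of_le_left (norm_nonneg s)
  have hr1 : r < 1 := max_lt hs ht
  -- the bound `‖term (n, d)‖ ≤ |d| r^{|d|}`
  have hbound : ∀ x : ℕ × (Fin 2 →₀ ℕ),
      ‖coeff x.1 f * (MvPowerSeries.coeff x.2 (A ^ x.1) * (s ^ x.2 0 * t ^ x.2 1))‖ ≤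
        (Finsupp.degree x.2) * r ^ (Finsupp.degree x.2) := by
    rintro ⟨n, d⟩
    dsimp only
    by_cases hnd : Finsupp.degree d < n
    · rw [coeff_pow_eq_zero_of_degree_lt hA0 hnd, zero_mul, mul_zero, norm_zero]
      exact mul_nonneg (Nat.cast_nonneg _) (pow_nonneg hr0 _)
    · push Not at hnd
      have b1 : ‖coeff n f‖ ≤ n := hf n
      have b2 : ‖MvPowerSeries.coeff d (A ^ n)‖ ≤ 1 := hA.pow n d
      have b3 : ‖s‖ ≤ r := le_max_left _ _
      have b4 : ‖t‖ ≤ r := le_max_right _ _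
      have b5 : (n : ℝ) ≤ Finsupp.degree d := by exact_mod_cast hnd
      rw [norm_mul, norm_mul, norm_mul, norm_pow, norm_pow]
      calc ‖coeff n f‖ * (‖MvPowerSeries.coeff d (A ^ n)‖ * (‖s‖ ^ d 0 * ‖t‖ ^ d 1))
          ≤ n * (1 * (r ^ d 0 * r ^ d 1)) := by gcongr
        _ = n * r ^ (Finsupp.degree d) := by rw [one_mul, ← pow_add, finsupp_degree_fin_two]
        _ ≤ (Finsupp.degree d) * r ^ (Finsupp.degree d) := by gcongr
  -- `m r^m → 0`
  rw [NormedAddGroup.tendsto_nhds_zero]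
  intro ε hε
  obtain ⟨N, hN⟩ : ∃ N : ℕ, ∀ m, N ≤ m → (m : ℝ) * r ^ m < ε := by
    have h := tendsto_self_mul_const_pow_of_lt_one hr0 hr1
    rw [Metric.tendsto_atTop] at h
    obtain ⟨N, hN⟩ := h ε hε
    refine ⟨N, fun m hm => ?_⟩
    have := hN m hm
    rw [Real.dist_eq, sub_zero, abs_of_nonneg (mul_nonneg (Nat.cast_nonneg _) (pow_nonneg hr0 _))] at this
    exact this
  -- the exceptional set is finite
  have hfin : {x : ℕ × (Fin 2 →₀ ℕ) | x.1 ≤ Finsupp.degree x.2 ∧ Finsupp.degree x.2 < N}.Finite := by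
    refine ((Set.finite_Iio N).prod (Finsupp.finite_of_degree_le (σ := Fin 2) N)).subset ?_
    intro x hx
    obtain ⟨h1, h2⟩ := hx
    simp only [Set.mem_prod, Set.mem_Iio, Set.mem_setOf_eq]
    exact ⟨by omega, by omega⟩
  rw [Filter.eventually_cofinite]
  refine hfin.subset fun x hx => ?_
  simp only [Set.mem_setOf_eq] at hx ⊢
  have hx' := not_lt.mp hx
  by_contra hcon
  push Not at hcon
  by_cases hnd : Finsupp.degree x.2 < x.1
  · rw [coeff_pow_eq_zero_of_degree_lt hA0 hnd, zero_mul, mul_zero, norm_zero] at hx'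
    exact absurd hε (not_lt.mpr hx')
  · push Not at hnd
    exact absurd ((hbound x).trans_lt (hN _ (hcon hnd))) (not_lt.mpr hx')

/-- **Evaluation commutes with substitution, non-integral outer series** (the Fubini argument of
AEC IV.6.4(a)): for `f ∈ ℚ_p⟦X⟧` with `‖coeff n f‖ ≤ n`, `A ∈ ℤ_p⟦z₁, z₂⟧` without constant term
and `‖s‖, ‖t‖ < 1`, the series defining `(f ∘ A)(s, t)` sums to `f(A(s, t)) = Σ' coeff n f · A(s,t)ⁿ`.
[Silverman AEC IV.6.4(a) (proof: "`log` will be a homomorphism … provided that `log(x)`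
converges")] [cite: SilvermanAEC2009, IV.6.4] -/
theorem hasSum_padicEval₂_powerSeries_subst (hf : ∀ n, ‖coeff n f‖ ≤ n) (hA : IsPadicInt A)
    (hA0 : MvPowerSeries.constantCoeff A = 0) (hs : ‖s‖ < 1) (ht : ‖t‖ < 1) :
    HasSum (fun d : Fin 2 →₀ ℕ => MvPowerSeries.coeff d (f.subst A) * (s ^ d 0 * t ^ d 1))
      (padicEval f (padicEval₂ A s t)) := by
  have hsum := summable_coeff_mul_coeff_pow hf hA hA0 hs ht
  -- summing over `d` first: the value is `f(A(s,t))`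
  have h1 : HasSum (fun n : ℕ => coeff n f * (padicEval₂ A s t) ^ n)
      (∑' x : ℕ × (Fin 2 →₀ ℕ), coeff x.1 f * (MvPowerSeries.coeff x.2 (A ^ x.1) * (s ^ x.2 0 * t ^ x.2 1))) := by
    refine hsum.hasSum.prod_fiberwise fun n => ?_
    rw [← padicEval₂_pow hA hs ht n]
    exact (hasSum_padicEval₂ (hA.pow n) hs ht).mul_left _
  have hval : padicEval f (padicEval₂ A s t) =
      ∑' x : ℕ × (Fin 2 →₀ ℕ), coeff x.1 f * (MvPowerSeries.coeff x.2 (A ^ x.1) * (s ^ x.2 0 * t ^ x.2 1)) := by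
    unfold padicEval
    exact h1.tsum_eq
  -- summing over `n` first: the coefficients of `f ∘ A`
  have hsum' := (Equiv.prodComm (Fin 2 →₀ ℕ) ℕ).summable_iff.mpr hsum
  have h2 : HasSum (fun d : Fin 2 →₀ ℕ => MvPowerSeries.coeff d (f.subst A) * (s ^ d 0 * t ^ d 1))
      (∑' y : (Fin 2 →₀ ℕ) × ℕ, coeff y.2 f * (MvPowerSeries.coeff y.1 (A ^ y.2) * (s ^ y.1 0 * t ^ y.1 1))) := by
    refine hsum'.hasSum.prod_fiberwise fun d => ?_
    have hfin : HasSum (fun n : ℕ => coeff n f * (MvPowerSeries.coeff d (A ^ n) * (s ^ d 0 * t ^ d 1)))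
        (∑ n ∈ Finset.range (Finsupp.degree d + 1),
          coeff n f * (MvPowerSeries.coeff d (A ^ n) * (s ^ d 0 * t ^ d 1))) :=
      hasSum_sum_of_ne_finset_zero fun n hn => by
        rw [Finset.mem_range, not_lt] at hn
        rw [coeff_pow_eq_zero_of_degree_lt hA0 (by omega), zero_mul, mul_zero]
    have hv : (∑ n ∈ Finset.range (Finsupp.degree d + 1),
        coeff n f * (MvPowerSeries.coeff d (A ^ n) * (s ^ d 0 * t ^ d 1))) =
        MvPowerSeries.coeff d (f.subst A) * (s ^ d 0 * t ^ d 1) := by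
      rw [coeff_powerSeries_subst_eq_sum hA0 d, Finset.sum_mul]
      exact Finset.sum_congr rfl fun n _ => by ring
    rw [← hv]
    exact hfin
  rw [hval, ← (Equiv.prodComm (Fin 2 →₀ ℕ) ℕ).tsum_eq]
  exact h2

end Fubini

end Literature.NumberTheory.EllipticCurves

namespace WeierstrassCurve

variable {p : ℕ} [Fact p.Prime] (W : WeierstrassCurve ℚ_[p]) [hW : W.IsIntegral ℤ_[p]]

/-- **AEC IV.6.4(a) for `Ê`: the formal logarithm is a homomorphism `Ê(pℤ_p) → ℚ_p`**: for a
`p`-integral `W/ℚ_p` and `‖s‖, ‖t‖ < 1`, `log_W(F(s, t)) = log_W(s) + log_W(t)` in `ℚ_p`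
(evaluate the tree's `formalLog_subst_formalGroupLaw`; the Fubini justification is
`hasSum_padicEval₂_powerSeries_subst` with `‖coeff n log‖ ≤ n`, AEC IV.6.3(a)).
[Silverman AEC IV.6.4(a)] [cite: SilvermanAEC2009, IV.6.4] -/
theorem padicFormalLog_padicEval₂_formalGroupLaw {s t : ℚ_[p]} (hs : ‖s‖ < 1) (ht : ‖t‖ < 1) :
    W.padicFormalLog (padicEval₂ W.formalGroupLaw s t) = W.padicFormalLog s + W.padicFormalLog t := by
  have hf : ∀ n, ‖coeff n W.formalLog‖ ≤ n := W.norm_coeff_formalLog_le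
  have h := hasSum_padicEval₂_powerSeries_subst hf W.isPadicInt_formalGroupLaw
    W.constantCoeff_formalGroupLaw hs ht
  have h0 := hasSum_padicEval₂_powerSeries_subst hf (IsPadicInt.X 0) (MvPowerSeries.constantCoeff_X 0) hs ht
  have h1 := hasSum_padicEval₂_powerSeries_subst hf (IsPadicInt.X 1) (MvPowerSeries.constantCoeff_X 1) hs ht
  rw [padicEval₂_X] at h0 h1
  rw [W.formalLog_subst_formalGroupLaw] at h
  have h' : HasSum (fun d : Fin 2 →₀ ℕ => MvPowerSeries.coeff d
      (W.formalLog.subst (MvPowerSeries.X 0 : MvPowerSeries (Fin 2) ℚ_[p]) +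
        W.formalLog.subst (MvPowerSeries.X 1 : MvPowerSeries (Fin 2) ℚ_[p])) * (s ^ d 0 * t ^ d 1))
      (padicEval W.formalLog s + padicEval W.formalLog t) := by
    have := h0.add h1
    simp only [Fin.isValue, Matrix.cons_val_zero, Matrix.cons_val_one, Matrix.cons_val_fin_one] at this
    simpa only [map_add, add_mul] using this
  rw [padicFormalLog_eq_padicEval, padicFormalLog_eq_padicEval, padicFormalLog_eq_padicEval]
  exact h.unique h'

/-- **Discharge of the named fact `WeierstrassCurve.padicLogPoint_add` (Silverman AEC VII.2.2 +
IV.6.4(a))**: for a minimal (hence `p`-integral) Weierstrass equation over `ℚ_p` and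
`P, Q ∈ E₁(ℚ_p)`, the sum `P + Q` lies in `E₁(ℚ_p)` and `log_W z(P + Q) = log_W z(P) + log_W z(Q)` —
the composite of `P ↦ z(P)`, `E₁(ℚ_p) → Ê(pℤ_p)` (`z(P + Q) = F(z(P), z(Q))`, VII.2.2) with the
homomorphism `log_Ê : Ê(pℤ_p) → ℚ_p` (IV.6.4(a)). [Silverman AEC VII.2.2, IV.6.4(a)]
[cite: SilvermanAEC2009, VII.2.2] -/
theorem padicLogPoint_add_holds : padicLogPoint_add := by
  intro p _ W _ P Q hP hQ
  refine ⟨isInReductionKernel_add hP hQ, ?_⟩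
  simp only [padicLogPoint]
  rw [← W.padicEval₂_formalGroupLaw_eq_formalParameter_add hP hQ]
  exact W.padicFormalLog_padicEval₂_formalGroupLaw (W.norm_formalParameter_lt_one hP)
    (W.norm_formalParameter_lt_one hQ)

end WeierstrassCurve
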